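import Summits.CriticalPhenomena.PercolationContinuityZ3.Theorems.PercAnnulusCrossingIICRerootingExact
import Summits.CriticalPhenomena.PercolationContinuityZ3.Theorems.PercAnnulusCrossingIICTwoPointUpper
import HarnessLib

/-!
# THE TOTAL-VARIATION DISTANCE BETWEEN THE IIC AT `0` AND AT `v` IS EXACTLY `1 − ν(0 ↔ v)` (lane RSW3, p1 gen 10)

builds on p205010 (kernel theorem, internal audit signed; external expert review pending) — used only through `θ(p_c) = 0` in the
`criticalProbI` / `ℤ²` corollaries; the main theorems are stated at any `p` with `θ(p) = 0` and (A2)□ at aspect `(s, L)`, `2 ≤ s`.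

Seat `prim-rsw3-p1` (gen 10); memo `run/shared/lean/prim/rsw3/P1-QM.md` §23.  Helper file; no definitions, no sorries.

Exact re-rooting (`…IICRerootingExact`: `ν_v = ν` on `O = {0 ↔ v}`), `ν_v(O) = ν(O)` (`…IICArmForgetsRoot`), `ν`-a.s. the unique infinite cluster contains the
origin and `ν_v`-a.s. `v ↔ ∞` give the distance between the two rooted IIC measures in closed form:

* **`abs_iicMeasure_map_shift_real_sub_real_le`** — `|ν_v(A) − ν(A)| ≤ 1 − ν(0 ↔ v)` for every event `A`;
* **`iicMeasure_map_shift_real_sub_real_eq`** — equality at `A = {v ↔ ∞} ∖ {0 ↔ v}`: `ν_v(A) − ν(A) = 1 − ν(0 ↔ v)`; so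
  **`sup_A |ν_v(A) − ν(A)| = 1 − ν(0 ↔ v) = ν(v ∉ C(0))`** — THE TOTAL-VARIATION DISTANCE BETWEEN THE IIC ROOTED AT `v` AND AT `0` IS THE
  PROBABILITY THAT `v` IS NOT IN THE IIC;
* **`iicMeasure_exists_forall_map_shift_real_sub_real_ge_criticalProbI`** — at `p_c(ℤ^d)` under (A2)□ (`2 ≤ s ≤ L`): for every `ε > 0`, for all `v`
  outside a box, some event separates `ν_v` from `ν` by `≥ 1 − ε` (zero density of the IIC, p1 gen 7): the rooted IIC measures are ASYMPTOTICALLY SINGULAR as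
  `v → ∞` — while agreeing asymptotically on far events (`…IICAsymptoticRootInvariance`) and on the tail σ-field (`…IICTailRootInvariance`).
References: H. Kesten, PTRF 73 (1986) Thm (3); D. Basu, A. Sapozhnikov, ECP 22 (2017) no. 26; A. Járai, Ann. Probab. 31 (2003).
-/

noncomputable section

namespace Summit.CriticalPhenomena.PercolationContinuityZ3.Theorems.Crossing

open MeasureTheory Filter Topology Literature.Probability.Percolation Literature.Probability.LatticeModels
open Literature.Probability.Percolation.DCT16
open Summit.CriticalPhenomena.PercolationContinuityZ3.Theorems.SurfaceTension
open scoped Literature.Probability.Percolation ENNReal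

variable {d : ℕ}

/-- **`|ν_v(A) − ν(A)| ≤ 1 − ν(0 ↔ v)` for every event `A`** (`θ(p) = 0`, (A2)□ at aspect `(s, L)`, `2 ≤ s`; `ν` an IIC probability measure at `p`, `0 < p`,
`d ≥ 1`): the two rooted IIC measures coincide on `{0 ↔ v}` and each puts mass `1 − ν(0 ↔ v)` on its complement.
[cite: BasuSapozhnikov2017ECP, Thm. 1.1 and Remark 2.1] [cite: Kesten1986, Thm. (3)] -/
theorem abs_iicMeasure_map_shift_real_sub_real_le (hd : 1 ≤ d) (p : unitInterval) (hp : 0 < (p : ℝ)) (hθ : theta (zdGraph d) 0 p = 0)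
    {s L : ℕ} (hs : 2 ≤ s) {ϰ : ℝ} (hϰ : 0 < ϰ) (hA2 : SetToSetQuasiMultAspectAt d p s L ϰ)
    {ν : Measure (BondConfig (Site d))} [IsProbabilityMeasure ν]
    (hν : ∀ (F : Finset (Sym2 (Site d))) (E : Set (BondConfig (Site d))), MeasurableSet E → DeterminedBy E ↑F →
      Tendsto (fun n : ℕ => (bondPercolation (zdGraph d) p).real (E ∩ siteToBoundary d n) / oneArmProb d p n)
        atTop (𝓝 (ν.real E)))
    (v : Site d) {A : Set (BondConfig (Site d))} (hA : MeasurableSet A) :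
    |(ν.map (BondConfig.relabel (sym2Equiv (Site.shift v)))).real A - ν.real A| ≤ 1 - ν.real (openConn (0 : Site d) v) := by
  set ν' := ν.map (BondConfig.relabel (sym2Equiv (Site.shift v))) with hν'
  haveI : IsProbabilityMeasure ν' := isProbabilityMeasure_iicMeasure_map_shift v
  have hO : MeasurableSet (openConn (0 : Site d) v : Set (BondConfig (Site d))) := measurableSet_openConn_holds 0 v
  have hsplit : ∀ (μ : Measure (BondConfig (Site d))) [IsFiniteMeasure μ],
      μ.real A = μ.real (A ∩ openConn (0 : Site d) v) + μ.real (A \ openConn (0 : Site d) v) :=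
    fun μ _ => (measureReal_inter_add_sdiff hO).symm
  have heq : ν'.real (A ∩ openConn (0 : Site d) v) = ν.real (A ∩ openConn (0 : Site d) v) :=
    iicMeasure_map_shift_real_inter_openConn_eq hd p hp hθ hs hϰ hA2 hν v hA
  have hOeq : ν'.real (openConn (0 : Site d) v) = ν.real (openConn (0 : Site d) v) := iicMeasure_map_shift_real_openConn_eq p hν v
  have hc1 : ν.real (A \ openConn (0 : Site d) v) ≤ 1 - ν.real (openConn (0 : Site d) v) := by
    rw [← probReal_compl_eq_one_sub hO]
    exact measureReal_mono (fun ω hω => hω.2) (measure_ne_top _ _)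
  have hc2 : ν'.real (A \ openConn (0 : Site d) v) ≤ 1 - ν.real (openConn (0 : Site d) v) := by
    rw [← hOeq, ← probReal_compl_eq_one_sub hO]
    exact measureReal_mono (fun ω hω => hω.2) (measure_ne_top _ _)
  rw [hsplit ν', hsplit ν, heq, abs_le]
  constructor <;> nlinarith [measureReal_nonneg (μ := ν) (s := A \ openConn (0 : Site d) v),
    measureReal_nonneg (μ := ν') (s := A \ openConn (0 : Site d) v)]

/-- **The bound is attained**: with `A = {v ↔ ∞} ∖ {0 ↔ v}`, `ν_v(A) − ν(A) = 1 − ν(0 ↔ v)` (`ν(A) = 0` since `ν`-a.s. the unique infinite cluster contains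
the origin, (A2)□ with `1 ≤ s`; `ν_v(A) = ν_v(0 ↮ v) = 1 − ν(0 ↔ v)` since `ν_v`-a.s. `v ↔ ∞`). Hence **`sup_A |ν_v(A) − ν(A)| = 1 − ν(0 ↔ v)`**.
[cite: BasuSapozhnikov2017ECP, §2 eq. (2.4), Thm. 1.1] [cite: Kesten1986, Thm. (3)] -/
theorem iicMeasure_map_shift_real_sub_real_eq (hd : 1 ≤ d) (p : unitInterval) (hp : 0 < (p : ℝ)) (hθ : theta (zdGraph d) 0 p = 0)
    {s L : ℕ} (hs : 1 ≤ s) {ϰ : ℝ} (hϰ : 0 < ϰ) (hA2 : SetToSetQuasiMultAspectAt d p s L ϰ)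
    {ν : Measure (BondConfig (Site d))} [IsProbabilityMeasure ν]
    (hν : ∀ (F : Finset (Sym2 (Site d))) (E : Set (BondConfig (Site d))), MeasurableSet E → DeterminedBy E ↑F →
      Tendsto (fun n : ℕ => (bondPercolation (zdGraph d) p).real (E ∩ siteToBoundary d n) / oneArmProb d p n)
        atTop (𝓝 (ν.real E)))
    (v : Site d) :
    (ν.map (BondConfig.relabel (sym2Equiv (Site.shift v)))).real (percolatesAt v \ openConn (0 : Site d) v) -
        ν.real (percolatesAt v \ openConn (0 : Site d) v) = 1 - ν.real (openConn (0 : Site d) v) := by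
  set ν' := ν.map (BondConfig.relabel (sym2Equiv (Site.shift v))) with hν'
  haveI : IsProbabilityMeasure ν' := isProbabilityMeasure_iicMeasure_map_shift v
  have hO : MeasurableSet (openConn (0 : Site d) v : Set (BondConfig (Site d))) := measurableSet_openConn_holds 0 v
  have hP : MeasurableSet (percolatesAt v : Set (BondConfig (Site d))) := measurableSet_percolatesAt_holds v
  -- `ν(A) = 0`
  have h0 : ν.real (percolatesAt v \ openConn (0 : Site d) v) = 0 := by
    rw [measureReal_def, measure_eq_zero_iff_ae_notMem.2, ENNReal.toReal_zero]
    filter_upwards [iicMeasure_ae_percolatesAt_iff_openConn hd p hp hθ hs hϰ hA2 hν] with ω hω hmem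
    exact hmem.2 ((hω v).1 hmem.1)
  -- `ν_v(A) = ν_v(Oᶜ) = 1 − ν_v(O) = 1 − ν(O)`
  have hOeq : ν'.real (openConn (0 : Site d) v) = ν.real (openConn (0 : Site d) v) := iicMeasure_map_shift_real_openConn_eq p hν v
  have hPc : ν'.real (percolatesAt v)ᶜ = 0 := by
    rw [measureReal_def, (prob_compl_eq_zero_iff hP).2 (iicMeasure_map_shift_percolatesAt_eq_one hd p hp hν v), ENNReal.toReal_zero]
  have h2 : ν'.real ((openConn (0 : Site d) v)ᶜ \ percolatesAt v) = 0 :=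
    le_antisymm ((measureReal_mono (fun ω hω => hω.2) (measure_ne_top _ _)).trans hPc.le) measureReal_nonneg
  have h3 := measureReal_inter_add_sdiff (μ := ν') (s := (openConn (0 : Site d) v)ᶜ) hP
  have hset : ((openConn (0 : Site d) v)ᶜ ∩ percolatesAt v : Set (BondConfig (Site d))) = percolatesAt v \ openConn (0 : Site d) v := by
    ext ω
    exact ⟨fun h => ⟨h.2, h.1⟩, fun h => ⟨h.2, h.1⟩⟩
  rw [hset, h2, add_zero] at h3
  rw [h3, probReal_compl_eq_one_sub hO, hOeq, h0, sub_zero]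

/-- **THE ROOTED IIC MEASURES ARE ASYMPTOTICALLY SINGULAR AS THE ROOT RECEDES**: at `p_c(ℤ^d)`, `d ≥ 2`, under (A2)□ at aspect `(s, L)` (`2 ≤ s ≤ L`), for every
IIC probability measure `ν` and every `ε > 0` there is `n₀` such that for every `v ∉ Λ(n₀)` some event `A` has `ν_v(A) − ν(A) ≥ 1 − ε` (the two-point function of
the IIC tends to zero, p1 gen 7 `iicMeasure_real_openConn_small_criticalProbI`) — although `ν_v` and `ν` agree on the tail σ-field and asymptotically on far events.
[cite: Kesten1986, Thm. (3), (1.12)–(1.13)] [cite: BasuSapozhnikov2017ECP, Thm. 1.1] -/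
theorem iicMeasure_exists_forall_map_shift_real_sub_real_ge_criticalProbI (hd : 2 ≤ d) {s L : ℕ} (hs : 2 ≤ s) (hsL : s ≤ L) {ϰ : ℝ} (hϰ : 0 < ϰ)
    (hA2 : SetToSetQuasiMultAspectAt d (criticalProbI d) s L ϰ)
    {ν : Measure (BondConfig (Site d))} [IsProbabilityMeasure ν]
    (hν : ∀ (F : Finset (Sym2 (Site d))) (E : Set (BondConfig (Site d))), MeasurableSet E → DeterminedBy E ↑F →
      Tendsto (fun n : ℕ => (bondPercolation (zdGraph d) (criticalProbI d)).real (E ∩ siteToBoundary d n) /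
        oneArmProb d (criticalProbI d) n) atTop (𝓝 (ν.real E)))
    {ε : ℝ} (hε : 0 < ε) :
    ∃ n₀ : ℕ, ∀ v : Site d, v ∉ box d n₀ → ∃ A : Set (BondConfig (Site d)), MeasurableSet A ∧
      1 - ε ≤ (ν.map (BondConfig.relabel (sym2Equiv (Site.shift v)))).real A - ν.real A := by
  have hpc : 0 < ((criticalProbI d : unitInterval) : ℝ) := by
    exact_mod_cast Literature.Barriers.CriticalPhenomena.criticalProbI_pos' (d := d) (by omega)
  obtain ⟨n₀, hn₀⟩ := iicMeasure_real_openConn_small_criticalProbI hd hs hsL hϰ hA2 hν hε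
  refine ⟨n₀, fun v hv => ⟨percolatesAt v \ openConn (0 : Site d) v,
    (measurableSet_percolatesAt_holds v).diff (measurableSet_openConn_holds 0 v), ?_⟩⟩
  rw [iicMeasure_map_shift_real_sub_real_eq (by omega) (criticalProbI d) hpc (CSH.percolationContinuity_allDimensions d hd) (by omega) hϰ hA2 hν v]
  linarith [hn₀ v hv]

/-- **Total-variation bound at `p_c(ℤ^d)`**: `|ν_v(A) − ν(A)| ≤ 1 − ν(0 ↔ v)` for every event (`d ≥ 2`, (A2)□ at aspect `(s, L)`, `2 ≤ s`).
[cite: BasuSapozhnikov2017ECP, Thm. 1.1] [cite: Kesten1986, Thm. (3)] -/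
theorem abs_iicMeasure_map_shift_real_sub_real_le_criticalProbI (hd : 2 ≤ d) {s L : ℕ} (hs : 2 ≤ s) {ϰ : ℝ} (hϰ : 0 < ϰ)
    (hA2 : SetToSetQuasiMultAspectAt d (criticalProbI d) s L ϰ)
    {ν : Measure (BondConfig (Site d))} [IsProbabilityMeasure ν]
    (hν : ∀ (F : Finset (Sym2 (Site d))) (E : Set (BondConfig (Site d))), MeasurableSet E → DeterminedBy E ↑F →
      Tendsto (fun n : ℕ => (bondPercolation (zdGraph d) (criticalProbI d)).real (E ∩ siteToBoundary d n) /
        oneArmProb d (criticalProbI d) n) atTop (𝓝 (ν.real E)))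
    (v : Site d) {A : Set (BondConfig (Site d))} (hA : MeasurableSet A) :
    |(ν.map (BondConfig.relabel (sym2Equiv (Site.shift v)))).real A - ν.real A| ≤ 1 - ν.real (openConn (0 : Site d) v) := by
  have hpc : 0 < ((criticalProbI d : unitInterval) : ℝ) := by
    exact_mod_cast Literature.Barriers.CriticalPhenomena.criticalProbI_pos' (d := d) (by omega)
  exact abs_iicMeasure_map_shift_real_sub_real_le (by omega) (criticalProbI d) hpc (CSH.percolationContinuity_allDimensions d hd) hs hϰ hA2 hν v hA

/-- **Total-variation bound for Kesten's planar IIC, unconditionally**: `|ν_v(A) − ν(A)| ≤ 1 − ν(0 ↔ v)` for every event. [cite: Kesten1986, Thm. (3)] -/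
theorem abs_iicMeasure_map_shift_real_sub_real_le_Z2 {ν : Measure (BondConfig (Site 2))} [IsProbabilityMeasure ν]
    (hν : ∀ (F : Finset (Sym2 (Site 2))) (E : Set (BondConfig (Site 2))), MeasurableSet E → DeterminedBy E ↑F →
      Tendsto (fun n : ℕ => (bondPercolation (zdGraph 2) (criticalProbI 2)).real (E ∩ siteToBoundary 2 n) /
        oneArmProb 2 (criticalProbI 2) n) atTop (𝓝 (ν.real E)))
    (v : Site 2) {A : Set (BondConfig (Site 2))} (hA : MeasurableSet A) :
    |(ν.map (BondConfig.relabel (sym2Equiv (Site.shift v)))).real A - ν.real A| ≤ 1 - ν.real (openConn (0 : Site 2) v) := by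
  obtain ⟨ϰ, hϰ, hA2⟩ := exists_setToSetQuasiMultAspectAt_two_of_criticalProbI_le
  exact abs_iicMeasure_map_shift_real_sub_real_le_criticalProbI (d := 2) le_rfl (by norm_num) hϰ (hA2 _ le_rfl) hν v hA

end Summit.CriticalPhenomena.PercolationContinuityZ3.Theorems.Crossing

end
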